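import Summits.BirchSwinnertonDyer.BirchSwinnertonDyer.Theorems.SignedLowerHalvesKobayashiMainConjectureSmallImageOneSignSwapIntegral
import Summits.BirchSwinnertonDyer.BirchSwinnertonDyer.Theorems.SignedLowerHalvesKobayashiMainConjectureSmallImageCycWindingMuThree
import Summits.BirchSwinnertonDyer.BirchSwinnertonDyer.Theorems.SignedLowerHalvesKobayashiLowerHalfLargeImageSignDefectX7
import HarnessLib

/-!
# Route `SignedLowerHalves`, crux L `SmallImageLowerHalfBothSigns` (item stmt-BirchSwinnertonDyer-23599), stub
# `stub_lambdaLowerThree_ns`: the CM-congruent locus at `p = 3`, part 2 — the displayed Mazur–Tate congruence may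
# be given in EITHER ORIENTATION with ANY integral constant: at `p = 3` the wall is the UNORIENTED integral
# congruence class (cell `bsd-ssimc`, width seat `bsd-line-slh-p3-w3` gen 7; ROUTE-INDEPENDENT helper,
# `--supports stmt-BirchSwinnertonDyer-23599 --as helper`; THEOREMS ONLY; closes nothing; BSD is not proved by any of this)

HONEST FRAMING. Part 1 (`…LambdaLowerThreeNsCongruence.lean`, this seat) reads the λ-stub on its third locus: at a
CM-congruent small-image X7 pair with `p = 3`, crux L's body `∀ ε, KobayashiLowerDivisibility W 3 ε` holds modulo
published facts BY NAME plus ONE displayed integral `S₀`-depleted Mazur–Tate congruence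
`hMT : ∀ n, ∃ q r, θ_n(f_E)·ιP − ι(c)·θ_n(f_{E′})·ιP′ = ι(ω_n q + 3r)` (`P, P′ = ∏_{S₀} 𝒫_ℓ`, ANY `c ∈ ℤ₃`), the
E-side rider being THEOREM B (input-free at `p = 3`). The display is ORIENTED: the constant sits on the partner.
What a congruence of modular symbols actually delivers (Corpuz–Lei 2025 §2, PRE: the cohomologically normalised
depleted symbols of `f_E` and `f_{E′}` are congruent mod `(ω_n, p)`; Faltings–Jordan multiplicity one at `p > k = 2`,
`p ∤ M`) is an integral congruence in SOME orientation — the one whose first form has the larger period ratio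
`Ω^{coh}/Ω⁺` — with an integral, possibly NON-unit constant. This file shows that at `p = 3` the orientation is
immaterial:

* §1 `isUnit_of_mazurTate_congr_rev_three`: a display in the REVERSE orientation (`θ_n(f_{E′})·ιP′ − ι(c)·θ_n(f_E)·ιP
  = ι(ω_n q + 3r)`, ANY `c ∈ ℤ₃`) forces `c ∈ ℤ₃ˣ` — THEOREM B for the PARTNER `E′` (good at `3`, `a₃(E′) = 0`; no
  image or CM hypothesis in `SmallImageCycWindingMuThree.exists_sign_hasUnitContent_three_of_isNewformOf`) is the
  rider of slh-p3 g4's `SmallImageOneSignSwapIntegral.isUnit_of_mazurTate_congr_of_hasUnitContent` read with the roles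
  of `E, E′` exchanged; then slh-p3 g4's `SmallImageOneSignSwap.mazurTate_congr_swap` returns the forward display
  with the unit `c⁻¹`;
* §2 hence part 1's conclusions from a REVERSE display: `∃ ε, KobayashiMainConjecture W 3 ε` (general partner with
  its main conjecture at every sign / CM partner by Pollack–Rubin), crux L's body `∀ ε, KobayashiLowerDivisibility W 3 ε`
  on class X7 (sign idle, slh-p1 g4), and the registered stub text per datum (`m = 0`);
* §3 the UNORIENTED form: the same conclusions from `hMT ∨ hMTrev` with one integral constant.

READING (D-0014; for the LEAD / pen): at `p = 3`, on the CM-congruent locus, the one displayed input of crux L /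
the λ-stub is an UNORIENTED integral depleted Mazur–Tate congruence class with an arbitrary integral constant —
exactly the shape that «both `Ω⁺`-normalised depleted symbol families are integral Hecke eigensymbols in a
multiplicity-one eigenspace» + Corpuz–Lei 2025 Thm 1 / §2 (PRE; hypotheses `p ≥ 3`, `p > k = 2`, unramified
coefficients, `E[p] ≅ E′[p]` — NO image hypothesis, all met on the locus) would print; the unit question (the
LEAD's wall W2cw «canonical ↔ Néron period at additive level») does NOT arise at `p = 3`, THEOREM B answering it on
both sides. PER PAIR; CONDITIONAL on the display; the stub (class-wide) is NOT proved; closes nothing.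

References: [Kobayashi2003] Thm. 1.2, 4.1, 5.2 iv), 7.4, Conjecture (p. 2); [PollackRubin2004] Thm. (p. 448);
[BDKim2009] Cor. 2.13, 2.5, Prop. 2.6; [GreenbergVatsal2000] Thm. (1.4), §3 Rem. 3.4; [PollackWeston2011] Thm. 4.1 (1),
Rem. 4.2; [Vaserstein1972SL2]; [Serre1972] §1.11 Prop. 12; [CorpuzLei2025] Thm 1, §2, Thm 4.5 (PRE); [FaltingsJordan1995].
-/

set_option autoImplicit false
-- D-0017: single-problem summit, the namespace repeats the problem name by design.
set_option linter.dupNamespace false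
noncomputable section

open scoped Classical MatrixGroups ModularForm BigOperators

open CongruenceSubgroup WeierstrassCurve NumberField IsDedekindDomain
  Literature.NumberTheory.EllipticCurves
  Literature.NumberTheory.EllipticCurves.ModularForms
  Literature.NumberTheory.EllipticCurves.Rank1Residual
  Literature.NumberTheory.EllipticCurves.Rank1Residual.Typed
  Literature.NumberTheory.EllipticCurves.Kobayashi2003 ZpExtension
  Literature.NumberTheory.EllipticCurves.GreenbergVatsal2000
  Literature.NumberTheory.EllipticCurves.BDKim2009
  Literature.NumberTheory.EllipticCurves.Sprung2017
  Summit.BirchSwinnertonDyer.Rank1Residual.X1.MuLambda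
  Summit.BirchSwinnertonDyer.Rank1Residual.Supersingular
  Summit.BirchSwinnertonDyer.BirchSwinnertonDyer.Theorems.SmallImageAnalyticTransfer
  Summit.BirchSwinnertonDyer.BirchSwinnertonDyer.Theorems.SmallImageOneSignSwap
  Summit.BirchSwinnertonDyer.BirchSwinnertonDyer.Theorems.SmallImageOneSignSwapIntegral
  Summit.BirchSwinnertonDyer.BirchSwinnertonDyer.Theorems.SmallImageCycWindingMuThree

namespace Summit.BirchSwinnertonDyer.BirchSwinnertonDyer.Theorems.SmallImageLambdaLowerThreeNsCongruenceRev

/-! ### §1 A reverse-oriented display has a unit constant at `p = 3` (THEOREM B for the partner) -/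

section Reverse

variable (p : ℕ) [Fact p.Prime]

/-- **At `p = 3` a REVERSE-oriented integral Mazur–Tate display has a UNIT constant.** For `E = W`, `E′ = W′`
good at `p = 3` with `a₃ = 0`, newforms `f₀`, `f₀′` (any levels), a finite `S₀ ∌ 3` and ANY `c ∈ ℤ₃` with
`∀ n, ∃ q r, θ_n(f₀′)·ιP′ − ι(c)·θ_n(f₀)·ιP = ι(ω_n q + 3r)` (`P, P′ = ∏_{S₀} 𝒫_ℓ`): `c ∈ ℤ₃ˣ`. THEOREM B for
`E′` (`SmallImageCycWindingMuThree.exists_sign_hasUnitContent_three_of_isNewformOf`: one of Pollack's `L^±_3(f₀′)`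
has unit content; no image / CM hypothesis) is the rider of slh-p3 g4's
`SmallImageOneSignSwapIntegral.isUnit_of_mazurTate_congr_of_hasUnitContent` with `E, E′` exchanged (`P′` of unit
content by `hasUnitContent_and_lam_eulerFactorProduct`). CONDITIONAL on the display; nothing asserted.
[cite: PollackWeston2011, Thm. 4.1 (1), Rem. 4.2] [cite: GreenbergVatsal2000, p. 2, (2) and §3 Remark 3.4]
[cite: Pollack2003, Prop. 6.18 and Cor. 5.11] -/
theorem isUnit_of_mazurTate_congr_rev_three (hp3 : p = 3)
    {W W' : WeierstrassCurve ℚ} [W.IsElliptic] [W.IsGloballyMinimal] [W'.IsElliptic] [W'.IsGloballyMinimal]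
    (hgood : W.HasGoodReductionAtPrime p) (hap : W.frobeniusTrace p = 0)
    (hgood' : W'.HasGoodReductionAtPrime p) (hap' : W'.frobeniusTrace p = 0)
    {N N' : ℕ} [NeZero N] [NeZero N'] {f₀ : CuspForm (Gamma0 N) 2} {f₀' : CuspForm (Gamma0 N') 2}
    (hf₀ : IsNewformOf W f₀) (hf₀' : IsNewformOf W' f₀')
    (S₀ : Finset (HeightOneSpectrum (𝓞 ℚ))) (hS₀ : ∀ v ∈ S₀, ((p : ℕ) : 𝓞 ℚ) ∉ v.asIdeal) (c : ℤ_[p])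
    (hMTrev : ∀ n : ℕ, ∃ q r : IwasawaAlgebra p,
      ((mazurTateElement f₀' p n).map (algebraMap ℚ ℚ_[p]) : PowerSeries ℚ_[p]) *
            iwasawaToPowerSeries p (eulerFactorProduct W' p S₀) -
          iwasawaToPowerSeries p (PowerSeries.C c) *
            (((mazurTateElement f₀ p n).map (algebraMap ℚ ℚ_[p]) : PowerSeries ℚ_[p]) *
              iwasawaToPowerSeries p (eulerFactorProduct W p S₀)) =
        iwasawaToPowerSeries p
          (toIwasawa p (cyclotomicOmega p n) * q + PowerSeries.C (p : ℤ_[p]) * r)) :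
    IsUnit c := by
  subst hp3
  obtain ⟨ε₁, L₁, hL₁, hL₁U⟩ := exists_sign_hasUnitContent_three_of_isNewformOf f₀' hf₀' hgood' hap'
  exact isUnit_of_mazurTate_congr_of_hasUnitContent (by decide) hgood' hap' hgood hap hf₀' hf₀
    (hasUnitContent_and_lam_eulerFactorProduct W' (by decide) S₀ hS₀).1 _ c hMTrev hL₁ hL₁U

/-- **From a reverse display to the forward one at `p = 3`**: under the hypotheses of
`isUnit_of_mazurTate_congr_rev_three`, the FORWARD display `∀ n, ∃ q r, θ_n(f₀)·ιP − ι(c′)·θ_n(f₀′)·ιP′ = ι(ω_n q + 3r)`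
holds with the integral constant `c′ = ↑(u⁻¹)`, `u` the unit of `c` (slh-p3 g4's `SmallImageOneSignSwap.mazurTate_congr_swap`).
CONDITIONAL on the display; nothing asserted. [cite: GreenbergVatsal2000, p. 2, (2)] [cite: PollackWeston2011, Thm. 4.1 (1), Rem. 4.2] -/
theorem exists_mazurTate_congr_of_rev_three (hp3 : p = 3)
    {W W' : WeierstrassCurve ℚ} [W.IsElliptic] [W.IsGloballyMinimal] [W'.IsElliptic] [W'.IsGloballyMinimal]
    (hgood : W.HasGoodReductionAtPrime p) (hap : W.frobeniusTrace p = 0)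
    (hgood' : W'.HasGoodReductionAtPrime p) (hap' : W'.frobeniusTrace p = 0)
    {N N' : ℕ} [NeZero N] [NeZero N'] {f₀ : CuspForm (Gamma0 N) 2} {f₀' : CuspForm (Gamma0 N') 2}
    (hf₀ : IsNewformOf W f₀) (hf₀' : IsNewformOf W' f₀')
    (S₀ : Finset (HeightOneSpectrum (𝓞 ℚ))) (hS₀ : ∀ v ∈ S₀, ((p : ℕ) : 𝓞 ℚ) ∉ v.asIdeal) (c : ℤ_[p])
    (hMTrev : ∀ n : ℕ, ∃ q r : IwasawaAlgebra p,
      ((mazurTateElement f₀' p n).map (algebraMap ℚ ℚ_[p]) : PowerSeries ℚ_[p]) *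
            iwasawaToPowerSeries p (eulerFactorProduct W' p S₀) -
          iwasawaToPowerSeries p (PowerSeries.C c) *
            (((mazurTateElement f₀ p n).map (algebraMap ℚ ℚ_[p]) : PowerSeries ℚ_[p]) *
              iwasawaToPowerSeries p (eulerFactorProduct W p S₀)) =
        iwasawaToPowerSeries p
          (toIwasawa p (cyclotomicOmega p n) * q + PowerSeries.C (p : ℤ_[p]) * r)) :
    ∃ c' : ℤ_[p], ∀ n : ℕ, ∃ q r : IwasawaAlgebra p,
      ((mazurTateElement f₀ p n).map (algebraMap ℚ ℚ_[p]) : PowerSeries ℚ_[p]) *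
            iwasawaToPowerSeries p (eulerFactorProduct W p S₀) -
          iwasawaToPowerSeries p (PowerSeries.C c') *
            (((mazurTateElement f₀' p n).map (algebraMap ℚ ℚ_[p]) : PowerSeries ℚ_[p]) *
              iwasawaToPowerSeries p (eulerFactorProduct W' p S₀)) =
        iwasawaToPowerSeries p
          (toIwasawa p (cyclotomicOmega p n) * q + PowerSeries.C (p : ℤ_[p]) * r) := by
  obtain ⟨u, hu⟩ := isUnit_of_mazurTate_congr_rev_three p hp3 hgood hap hgood' hap' hf₀ hf₀' S₀ hS₀ c hMTrev
  subst hu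
  exact ⟨((u⁻¹ : ℤ_[p]ˣ) : ℤ_[p]),
    mazurTate_congr_swap f₀' f₀ (eulerFactorProduct W' p S₀) (eulerFactorProduct W p S₀) u hMTrev⟩

end Reverse

/-! ### §2 Part 1's conclusions from a display in EITHER orientation -/

section Either

variable (W : WeierstrassCurve ℚ) [W.IsElliptic] [W.IsGloballyMinimal] (p : ℕ) [Fact p.Prime]

/-- **`∃ ε, KobayashiMainConjecture W 3 ε` at a `3`-congruent pair from a display in EITHER orientation, general
partner.** Published inputs BY NAME (`h12`, `h41` rational, `h5`/`h3`, `h09`/`hKim`, `hmod`); per pair: `p = 3` good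
for `E` with `a₃ = 0`, conductor-level newform `f₀`, a partner `E′` good at `3` with `a₃(E′) = 0`, `Γ_ℚ`-iso
`E[3] ≃ E′[3]`, its newform `f₀′`, its main conjecture at every sign (`hMC′`), `S₀ ∌ 3` through the bad places of
both, ANY `c ∈ ℤ₃`, and the integral depleted Mazur–Tate display in the forward OR the reverse orientation. Forward:
slh-p3 g4's `…_of_mainConjecture_intConst` with THEOREM B for `E` as rider; reverse: §1 turns it forward first
(THEOREM B for `E′`). PER PAIR; CONDITIONAL; closes nothing. [cite: GreenbergVatsal2000, Thm. (1.4) and §3 Remark 3.4]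
[cite: Kobayashi2003, Thm. 1.2, Thm. 4.1 (p. 8) and Conjecture (p. 2)] [cite: BDKim2009, Cor. 2.13, Cor. 2.5 and Prop. 2.6 (pp. 185–187)]
[cite: PollackWeston2011, Thm. 4.1 (1), Rem. 4.2] -/
theorem exists_kobayashiMainConjecture_three_of_mazurTate_congr_or_rev_of_mainConjecture (hp3 : p = 3)
    (h12 : Kobayashi2003.thm12_signedSelmerDual_finite_torsion)
    (h41 : Kobayashi2003.thm41_signedCharIdeal_divisibility)
    (h5 : realPeriodRat_eq_unit_mul_plusPeriod) (h3 : realPeriodRat_eq_unit_mul_plusPeriod_three)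
    (h09 : cor213_signedMu_eq_zero_iff_of_torsionIso)
    (hKim : BDKim2009.cor213_signedLambda_add_sum_delta_eq_of_torsionIso)
    (hmod : nonempty_modularParametrizationData)
    (hgood : W.HasGoodReductionAtPrime p) (hap : W.frobeniusTrace p = 0)
    [NeZero (W.conductorNorm ℤ)] {f₀ : CuspForm (Gamma0 (W.conductorNorm ℤ)) 2} (hf₀ : IsNewformOf W f₀)
    {W' : WeierstrassCurve ℚ} [W'.IsElliptic] [W'.IsGloballyMinimal]
    (hgood' : W'.HasGoodReductionAtPrime p) (hap' : W'.frobeniusTrace p = 0)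
    (he : ∃ e : geomTorsion W (p : ℤ) ≃+ geomTorsion W' (p : ℤ),
      ∀ (σ : Field.absoluteGaloisGroup ℚ) (P : geomTorsion W (p : ℤ)), e (σ • P) = σ • e P)
    [NeZero (W'.conductorNorm ℤ)] {f₀' : CuspForm (Gamma0 (W'.conductorNorm ℤ)) 2}
    (hf₀' : IsNewformOf W' f₀') (hMC' : ∀ ε : ℤˣ, KobayashiMainConjecture W' p ε)
    (S₀ : Finset (HeightOneSpectrum (𝓞 ℚ))) (hS₀ : ∀ v ∈ S₀, ((p : ℕ) : 𝓞 ℚ) ∉ v.asIdeal)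
    (hS₀W : ∀ v : HeightOneSpectrum (𝓞 ℚ), ¬ W.HasGoodReductionAt v → v ∈ S₀)
    (hS₀W' : ∀ v : HeightOneSpectrum (𝓞 ℚ), ¬ W'.HasGoodReductionAt v → v ∈ S₀)
    (c : ℤ_[p])
    (hMT : (∀ n : ℕ, ∃ q r : IwasawaAlgebra p,
      ((mazurTateElement f₀ p n).map (algebraMap ℚ ℚ_[p]) : PowerSeries ℚ_[p]) *
            iwasawaToPowerSeries p (eulerFactorProduct W p S₀) -
          iwasawaToPowerSeries p (PowerSeries.C c) *
            (((mazurTateElement f₀' p n).map (algebraMap ℚ ℚ_[p]) : PowerSeries ℚ_[p]) *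
              iwasawaToPowerSeries p (eulerFactorProduct W' p S₀)) =
        iwasawaToPowerSeries p
          (toIwasawa p (cyclotomicOmega p n) * q + PowerSeries.C (p : ℤ_[p]) * r)) ∨
      (∀ n : ℕ, ∃ q r : IwasawaAlgebra p,
      ((mazurTateElement f₀' p n).map (algebraMap ℚ ℚ_[p]) : PowerSeries ℚ_[p]) *
            iwasawaToPowerSeries p (eulerFactorProduct W' p S₀) -
          iwasawaToPowerSeries p (PowerSeries.C c) *
            (((mazurTateElement f₀ p n).map (algebraMap ℚ ℚ_[p]) : PowerSeries ℚ_[p]) *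
              iwasawaToPowerSeries p (eulerFactorProduct W p S₀)) =
        iwasawaToPowerSeries p
          (toIwasawa p (cyclotomicOmega p n) * q + PowerSeries.C (p : ℤ_[p]) * r))) :
    ∃ ε : ℤˣ, KobayashiMainConjecture W p ε := by
  have hp2 : p ≠ 2 := by omega
  -- THEOREM B for `E`: the E-side rider, input-free at `p = 3`
  obtain ⟨ε₀, L₀, hL₀, hL₀U⟩ : ∃ (ε₀ : ℤˣ) (L₀ : IwasawaAlgebra p),
      IsSignedPAdicLFunction f₀ p ε₀ L₀ ∧ HasUnitContent L₀ := by
    subst hp3; exact exists_sign_hasUnitContent_three_of_isNewformOf f₀ hf₀ hgood hap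
  -- a forward display with SOME integral constant
  obtain ⟨c', hMT'⟩ : ∃ c' : ℤ_[p], ∀ n : ℕ, ∃ q r : IwasawaAlgebra p,
      ((mazurTateElement f₀ p n).map (algebraMap ℚ ℚ_[p]) : PowerSeries ℚ_[p]) *
            iwasawaToPowerSeries p (eulerFactorProduct W p S₀) -
          iwasawaToPowerSeries p (PowerSeries.C c') *
            (((mazurTateElement f₀' p n).map (algebraMap ℚ ℚ_[p]) : PowerSeries ℚ_[p]) *
              iwasawaToPowerSeries p (eulerFactorProduct W' p S₀)) =
        iwasawaToPowerSeries p
          (toIwasawa p (cyclotomicOmega p n) * q + PowerSeries.C (p : ℤ_[p]) * r) := by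
    rcases hMT with h | h
    · exact ⟨c, h⟩
    · exact exists_mazurTate_congr_of_rev_three p hp3 hgood hap hgood' hap' hf₀ hf₀' S₀ hS₀ c h
  exact ⟨ε₀, kobayashiMainConjecture_of_oneSign_of_mazurTate_congr_of_mainConjecture_intConst h12 h41 h5 h3 h09
    hKim hmod hp2 hgood hap hf₀ hL₀ hL₀U hgood' hap' he hf₀' (hMC' ε₀) S₀ hS₀ hS₀W hS₀W' c' hMT'⟩

/-- **Crux L's body AT A CM-CONGRUENT X7 PAIR WITH `p = 3` from an UNORIENTED display**: on class X7 at `p = 3`,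
`a₃ = 0`, with a CM partner `W′` (good supersingular at `3`, `a₃ = 0`, `Γ_ℚ`-iso `E[3] ≃ E′[3]`; main conjecture =
Pollack–Rubin 2004 `hPR` BY NAME), `S₀ ∌ 3`, ANY `c ∈ ℤ₃` and the integral depleted Mazur–Tate display in EITHER
orientation: `∀ ε, KobayashiLowerDivisibility W 3 ε` (main conjecture at THEOREM B's sign ⟹ Eisenstein half ⟹
every sign by slh-p1 g4's `SignDefect.X7.exists_kobayashiLowerDivisibility_iff_forall`, joint package `hJ` by name).
Published inputs by name only; NO rider, NO certificate, NO unit hypothesis, NO orientation. PER PAIR; CONDITIONAL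
on the display; NOT a class theorem; closes nothing. [cite: PollackRubin2004, Theorem (p. 448) = Thm. 7.3]
[cite: Kobayashi2003, Thm. 5.2 iv) (p. 9), Thm. 7.4 and its proof (p. 13), Conjecture (p. 2)]
[cite: BDKim2009, Cor. 2.13, Cor. 2.5 and Prop. 2.6 (pp. 185–187)] [cite: PollackWeston2011, Thm. 4.1 (1), Rem. 4.2] -/
theorem forall_kobayashiLowerDivisibility_three_of_mazurTate_congr_or_rev_of_cmPartner (hp3 : p = 3)
    (h12 : Kobayashi2003.thm12_signedSelmerDual_finite_torsion)
    (h41 : Kobayashi2003.thm41_signedCharIdeal_divisibility)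
    (h5 : realPeriodRat_eq_unit_mul_plusPeriod) (h3 : realPeriodRat_eq_unit_mul_plusPeriod_three)
    (h09 : cor213_signedMu_eq_zero_iff_of_torsionIso)
    (hKim : BDKim2009.cor213_signedLambda_add_sum_delta_eq_of_torsionIso)
    (hPR : PollackRubin2004.mainTheorem_signedCharIdeal_eq_of_cm)
    (hmod : nonempty_modularParametrizationData)
    (hJ : Kobayashi2003.thm62_63_73_signedColemanKato_zetaJoint)
    (hX : ClassX7 W p) (hap : W.frobeniusTrace p = 0)
    [NeZero (W.conductorNorm ℤ)] {f₀ : CuspForm (Gamma0 (W.conductorNorm ℤ)) 2} (hf₀ : IsNewformOf W f₀)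
    {W' : WeierstrassCurve ℚ} [W'.IsElliptic] [W'.IsGloballyMinimal]
    (hcm' : W'.HasCM) (hss' : GoodSS W' p) (hap' : W'.frobeniusTrace p = 0)
    (he : ∃ e : geomTorsion W (p : ℤ) ≃+ geomTorsion W' (p : ℤ),
      ∀ (σ : Field.absoluteGaloisGroup ℚ) (P : geomTorsion W (p : ℤ)), e (σ • P) = σ • e P)
    [NeZero (W'.conductorNorm ℤ)] {f₀' : CuspForm (Gamma0 (W'.conductorNorm ℤ)) 2}
    (hf₀' : IsNewformOf W' f₀')
    (S₀ : Finset (HeightOneSpectrum (𝓞 ℚ))) (hS₀ : ∀ v ∈ S₀, ((p : ℕ) : 𝓞 ℚ) ∉ v.asIdeal)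
    (hS₀W : ∀ v : HeightOneSpectrum (𝓞 ℚ), ¬ W.HasGoodReductionAt v → v ∈ S₀)
    (hS₀W' : ∀ v : HeightOneSpectrum (𝓞 ℚ), ¬ W'.HasGoodReductionAt v → v ∈ S₀)
    (c : ℤ_[p])
    (hMT : (∀ n : ℕ, ∃ q r : IwasawaAlgebra p,
      ((mazurTateElement f₀ p n).map (algebraMap ℚ ℚ_[p]) : PowerSeries ℚ_[p]) *
            iwasawaToPowerSeries p (eulerFactorProduct W p S₀) -
          iwasawaToPowerSeries p (PowerSeries.C c) *
            (((mazurTateElement f₀' p n).map (algebraMap ℚ ℚ_[p]) : PowerSeries ℚ_[p]) *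
              iwasawaToPowerSeries p (eulerFactorProduct W' p S₀)) =
        iwasawaToPowerSeries p
          (toIwasawa p (cyclotomicOmega p n) * q + PowerSeries.C (p : ℤ_[p]) * r)) ∨
      (∀ n : ℕ, ∃ q r : IwasawaAlgebra p,
      ((mazurTateElement f₀' p n).map (algebraMap ℚ ℚ_[p]) : PowerSeries ℚ_[p]) *
            iwasawaToPowerSeries p (eulerFactorProduct W' p S₀) -
          iwasawaToPowerSeries p (PowerSeries.C c) *
            (((mazurTateElement f₀ p n).map (algebraMap ℚ ℚ_[p]) : PowerSeries ℚ_[p]) *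
              iwasawaToPowerSeries p (eulerFactorProduct W p S₀)) =
        iwasawaToPowerSeries p
          (toIwasawa p (cyclotomicOmega p n) * q + PowerSeries.C (p : ℤ_[p]) * r))) :
    ∀ ε : ℤˣ, KobayashiLowerDivisibility W p ε := by
  have hp2 : p ≠ 2 := by omega
  obtain ⟨ε₀, hMC⟩ := exists_kobayashiMainConjecture_three_of_mazurTate_congr_or_rev_of_mainConjecture W p hp3
    h12 h41 h5 h3 h09 hKim hmod hX.1.1 hap hf₀ hss'.1 hap' he hf₀'
    (kobayashiMainConjecture_of_pollackRubin_of_goodSS W' p hPR hcm' hp2 hss') S₀ hS₀ hS₀W hS₀W' c hMT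
  exact (SignDefect.X7.exists_kobayashiLowerDivisibility_iff_forall W p h12 h5 h3 hJ hp2 hX hap).mp
    ⟨ε₀, kobayashiLowerDivisibility_of_mainConjecture hMC⟩

/-- **The registered stub's text at a CM-congruent `p = 3` pair from an UNORIENTED display** (the stub's own binders
`p = 3`, `ClassX7`, `¬CM`, `a₃ = 0`, `¬Surj` — the image binders idle): for EVERY sign, cyclotomic datum, newform,
period ratio, Pollack pair and dual datum, `∃ g h m, char X^ε = (g) ∧ ι(C(3^m)·g) = C ϖ · ι(L₃^ε·h)`, indeed with
`m = 0`. Published inputs by name only + the display (either orientation, any integral constant). PER PAIR;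
CONDITIONAL; the stub (class-wide) is NOT proved; closes nothing. [cite: Kobayashi2003, Conjecture (p. 2), Thm. 4.1 (p. 8), Thm. 7.4 (p. 13)]
[cite: PollackRubin2004, Theorem (p. 448) = Thm. 7.3] [cite: BDKim2009, Cor. 2.13, Cor. 2.5 and Prop. 2.6 (pp. 185–187)] -/
theorem lambdaShape_three_of_mazurTate_congr_or_rev_of_cmPartner (hp3 : p = 3)
    (h12 : Kobayashi2003.thm12_signedSelmerDual_finite_torsion)
    (h41 : Kobayashi2003.thm41_signedCharIdeal_divisibility)
    (h5 : realPeriodRat_eq_unit_mul_plusPeriod) (h3 : realPeriodRat_eq_unit_mul_plusPeriod_three)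
    (h09 : cor213_signedMu_eq_zero_iff_of_torsionIso)
    (hKim : BDKim2009.cor213_signedLambda_add_sum_delta_eq_of_torsionIso)
    (hPR : PollackRubin2004.mainTheorem_signedCharIdeal_eq_of_cm)
    (hmod : nonempty_modularParametrizationData)
    (hJ : Kobayashi2003.thm62_63_73_signedColemanKato_zetaJoint)
    (hX : ClassX7 W p) (_hcm : ¬ W.HasCM) (hap : W.frobeniusTrace p = 0) (_hns : ¬ Surj W p)
    [NeZero (W.conductorNorm ℤ)] {f₀ : CuspForm (Gamma0 (W.conductorNorm ℤ)) 2} (hf₀ : IsNewformOf W f₀)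
    {W' : WeierstrassCurve ℚ} [W'.IsElliptic] [W'.IsGloballyMinimal]
    (hcm' : W'.HasCM) (hss' : GoodSS W' p) (hap' : W'.frobeniusTrace p = 0)
    (he : ∃ e : geomTorsion W (p : ℤ) ≃+ geomTorsion W' (p : ℤ),
      ∀ (σ : Field.absoluteGaloisGroup ℚ) (P : geomTorsion W (p : ℤ)), e (σ • P) = σ • e P)
    [NeZero (W'.conductorNorm ℤ)] {f₀' : CuspForm (Gamma0 (W'.conductorNorm ℤ)) 2}
    (hf₀' : IsNewformOf W' f₀')
    (S₀ : Finset (HeightOneSpectrum (𝓞 ℚ))) (hS₀ : ∀ v ∈ S₀, ((p : ℕ) : 𝓞 ℚ) ∉ v.asIdeal)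
    (hS₀W : ∀ v : HeightOneSpectrum (𝓞 ℚ), ¬ W.HasGoodReductionAt v → v ∈ S₀)
    (hS₀W' : ∀ v : HeightOneSpectrum (𝓞 ℚ), ¬ W'.HasGoodReductionAt v → v ∈ S₀)
    (c : ℤ_[p])
    (hMT : (∀ n : ℕ, ∃ q r : IwasawaAlgebra p,
      ((mazurTateElement f₀ p n).map (algebraMap ℚ ℚ_[p]) : PowerSeries ℚ_[p]) *
            iwasawaToPowerSeries p (eulerFactorProduct W p S₀) -
          iwasawaToPowerSeries p (PowerSeries.C c) *
            (((mazurTateElement f₀' p n).map (algebraMap ℚ ℚ_[p]) : PowerSeries ℚ_[p]) *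
              iwasawaToPowerSeries p (eulerFactorProduct W' p S₀)) =
        iwasawaToPowerSeries p
          (toIwasawa p (cyclotomicOmega p n) * q + PowerSeries.C (p : ℤ_[p]) * r)) ∨
      (∀ n : ℕ, ∃ q r : IwasawaAlgebra p,
      ((mazurTateElement f₀' p n).map (algebraMap ℚ ℚ_[p]) : PowerSeries ℚ_[p]) *
            iwasawaToPowerSeries p (eulerFactorProduct W' p S₀) -
          iwasawaToPowerSeries p (PowerSeries.C c) *
            (((mazurTateElement f₀ p n).map (algebraMap ℚ ℚ_[p]) : PowerSeries ℚ_[p]) *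
              iwasawaToPowerSeries p (eulerFactorProduct W p S₀)) =
        iwasawaToPowerSeries p
          (toIwasawa p (cyclotomicOmega p n) * q + PowerSeries.C (p : ℤ_[p]) * r)))
    (ε : ℤˣ) (κ : ZpExtension ℚ p) (γ : Field.absoluteGaloisGroup ℚ) (hκ : κ.IsCyclotomic)
    (hγ : κ.IsTopGenerator γ) (hγ' : IsCyclotomicVariable p γ) (f : CuspForm (Gamma0 (W.conductorNorm ℤ)) 2)
    (hf : IsNewformOf W f) (ϖ : ℚ) (hϖ : (ϖ : ℝ) * W.realPeriodRat = plusPeriod f)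
    (Lplus Lminus : IwasawaAlgebra p) (hPP : IsPollackPair f p Lplus Lminus) (D : SignedSelmerDualData W κ γ ε) :
    ∃ (g h : IwasawaAlgebra p) (m : ℕ), D.charIdeal = Ideal.span {g} ∧
      iwasawaToPowerSeries p (PowerSeries.C ((p : ℤ_[p]) ^ m) * g) =
        PowerSeries.C (ϖ : ℚ_[p]) * iwasawaToPowerSeries p (kobayashiL ε Lplus Lminus * h) := by
  obtain ⟨g, h', hg, hι⟩ := forall_kobayashiLowerDivisibility_three_of_mazurTate_congr_or_rev_of_cmPartner W p hp3
    h12 h41 h5 h3 h09 hKim hPR hmod hJ hX hap hf₀ hcm' hss' hap' he hf₀' S₀ hS₀ hS₀W hS₀W' c hMT ε κ γ hκ hγ hγ' f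
    hf ϖ hϖ Lplus Lminus hPP D
  exact ⟨g, h', 0, hg, by rw [pow_zero, map_one, one_mul]; exact hι⟩

end Either

end Summit.BirchSwinnertonDyer.BirchSwinnertonDyer.Theorems.SmallImageLambdaLowerThreeNsCongruenceRev

end
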